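import Summits.Langlands.Statement
import Literature.NumberTheory.GaloisRepresentations.SymplecticMultiplier
import Literature.NumberTheory.GaloisRepresentations.CrystallineOrdinaryShape
import Literature.NumberTheory.Automorphic.LocalComponentBJGenericProofs
import HarnessLib

/-!
# Route PhantomRMYoshida — `PhantomRMJunction` (stmt-Langlands-13643) from its four typed pieces, STRUCTURAL

Crux-strategist (unit `cstrat-stmt-Langlands-13643-r1`, EXEMPT-46 re-exam, verdict RESTATED; BC2 REDIRECT),
2026-08-17.  `PhantomRMJunction := ∀ _ : PhantomRMSector, _root_.Langlands` is the route's D-0027 frame item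
("the rest of the summit"; summit-equivalent given the target — `phantomRMJunction_iff_of_target`, p84203).
This module PROVES, sorry-free and WITHOUT importing any `Theses` file (so that the gate can link it from the
route file: `route edit --split PhantomRMJunction … --glue-by`), the assembly of the typed decomposition of the
junction along the seams of the REVISED summit `Langlands = ∀ F, Nonempty (ReciprocityData F) ∧ ∀ Rec n, 0 < n →
∀ hcpt, (A) ∧ (B)` (statement revision p141787, 2026-08-17):

* N  `CanonicalReciprocityData` — the non-vacuity conjunct VERBATIM (= item stmt-Langlands-17930): canonically
     normalised (Artin- and ε-pinned) local Langlands data at every completion of every number field;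
* U  `PinnedRecRigidity` — RIGIDITY: two pinned reciprocity data agree on every GENERIC class of every
     completion (Henniart 1993 Thm 1.1 on supercuspidals = the uniqueness half of the tree's named fact
     `localLanglands_gl`; Jacquet–Langlands / JPSS 1983 §8 / Henniart 2002 Thm 1.7 on generic
     non-supercuspidal classes) — the one obligation the `∃ Rec ↦ ∀ Rec` re-type adds to every frame item;
* A′ `AutomorphicToGaloisOfDatum` — direction (A) (Clozel / Buzzard–Gee 3.2.2 / Taylor Conj 7: irreducible
     geometric avatars with local–global compatibility everywhere, unique up to conjugacy) for SOME pinned datum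
     of each number field, given that pinned data exist;
* B′ `GaloisToAutomorphicOfDatum` — direction (B) (Fontaine–Mazur–Langlands, Taylor Conj 8) likewise.

**Theorem** (`phantomRMJunction_of_pieces`).  `N → U → A′ → B′ → (X → Langlands)`, every hypothesis and the
conclusion written as TEXT (the route decls unfolded; by-name certificate = planner `Sketch.lean`, rc 0).  Proof
(≈ 40 tactic lines, not a one-line seam, but short): N is the first conjunct; for an ARBITRARY pinned datum `Rec`,
clause (A) is (A) at the datum of A′ and clause (B) is (B) at the datum of B′, TRANSPORTED to `Rec` along U —
the reciprocity datum enters `Corresponds` only through `rec_v` at the local components of cuspidal `π`, which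
are generic (in tree: `CuspidalAutomorphicRepData.exists_isGeneric_of_hasLocalComponentAt`, Shalika 1974), and
`ReciprocityData.pst` is the pinned Fontaine datum, `rfl`-independent of `Rec`.  HONESTY CAVEAT (for the judge):
the sector hypothesis X = `PhantomRMSector` is bound and NOT used — the four pieces decompose `Langlands`
itself and the junction follows by weakening (X is one measure-zero cell of B′: n = 4, F = ℚ, ordinary
symplectic weight-(2,2), residually Yoshida); see STRATEGY-CENSUS.md on the item for why no typed assembly
toward `Langlands` can consume X non-vacuously.  Transport lemmas as in the landed
`Theorems/DyadicOddResidueSectorComplementRigidityTransport.lean` (line `reciprocity-rigidity`, stmt-18745),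
re-proved here on the generic-class form of rigidity.  Axioms: propext, Classical.choice, Quot.sound.

References: G. Henniart, Invent. Math. 113 (1993), Thm. 1.1 [Henniarts1993]; M. Harris, R. Taylor, Ann. Math.
Stud. 151 (2001), Thm. A [HarrisTaylorAMS2001]; K. Buzzard, T. Gee, LMS LNS 414 (2014), Conj. 3.2.1–3.2.2
[BuzzardGeeLMS2014]; J.-M. Fontaine, B. Mazur (1995), Conj. 1 [FontaineMazurGeometric1995]; R. Taylor, Ann. Fac.
Sci. Toulouse 13 (2004), Conj. 7–8 [TaylorGaloisRepresentations2004]; J. A. Shalika, Ann. of Math. 100 (1974),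
Thm. 5.9 [Shalika1974].
-/

noncomputable section

set_option linter.dupNamespace false -- project-wide option; `Summit.Langlands.Langlands` is the mandated namespace

open scoped MatrixGroups NumberField
open NumberField IsDedekindDomain Filter
open Literature.NumberTheory.Automorphic Literature.NumberTheory.GaloisRepresentations
open Summit.Langlands

namespace Summit.Langlands.Langlands.Theorems.PhantomRMYoshidaJunctionSplit

section Transport

variable {K : Type} [Field K] [NumberField K] {n : ℕ} {hcpt : isCompact_glFiniteIntegralLevel n K}
  {ℓ : ℕ} [Fact ℓ.Prime]

/-- Rigidity on generic classes ⇒ agreement on the local components of cuspidal `π` (genericity of local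
components, in tree). [cite: Shalika1974, Thm. 5.9] -/
theorem recGL_eq_of_hasLocalComponentAt
    (hU : ∀ (K : Type) [Field K] [NumberField K] (Rec Rec' : Summit.Langlands.ReciprocityData K) (v : IsDedekindDomain.HeightOneSpectrum (NumberField.RingOfIntegers K)) (n : ℕ) (πv : Literature.NumberTheory.Automorphic.SmoothIrrep (GL (Fin n) (v.adicCompletion K))) (ψ : AddChar (v.adicCompletion K) Circle), ψ.IsContinuousNontrivial → Literature.NumberTheory.Automorphic.IsGeneric πv.ρ ψ → (Rec.llc v).recGL n (Literature.NumberTheory.Automorphic.IrrClass.mk πv) = (Rec'.llc v).recGL n (Literature.NumberTheory.Automorphic.IrrClass.mk πv))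
    (Rec Rec' : ReciprocityData K) (hn : 0 < n) (π : CuspidalAutomorphicRepData n K hcpt)
    (v : HeightOneSpectrum (𝓞 K)) (πv : SmoothIrrep (GL (Fin n) (v.adicCompletion K)))
    (hπv : π.1.HasLocalComponentAt v πv.ρ) :
    (Rec.llc v).recGL n (IrrClass.mk πv) = (Rec'.llc v).recGL n (IrrClass.mk πv) := by
  haveI : NeZero n := ⟨hn.ne'⟩
  obtain ⟨ψ, hψ, hg⟩ := π.exists_isGeneric_of_hasLocalComponentAt v πv.ρ πv.isSmooth hπv
  exact hU K Rec Rec' v n πv ψ hψ hg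

/-- Transport of local–global compatibility at `v` along rigid data (`ReciprocityData.pst` is pinned: `rfl`).
[cite: Henniarts1993, Thm 1.1] -/
theorem localGlobalCompatibleAt_transport
    (hU : ∀ (K : Type) [Field K] [NumberField K] (Rec Rec' : Summit.Langlands.ReciprocityData K) (v : IsDedekindDomain.HeightOneSpectrum (NumberField.RingOfIntegers K)) (n : ℕ) (πv : Literature.NumberTheory.Automorphic.SmoothIrrep (GL (Fin n) (v.adicCompletion K))) (ψ : AddChar (v.adicCompletion K) Circle), ψ.IsContinuousNontrivial → Literature.NumberTheory.Automorphic.IsGeneric πv.ρ ψ → (Rec.llc v).recGL n (Literature.NumberTheory.Automorphic.IrrClass.mk πv) = (Rec'.llc v).recGL n (Literature.NumberTheory.Automorphic.IrrClass.mk πv))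
    (Rec Rec' : ReciprocityData K) (hn : 0 < n) (ι : PadicAlgCl ℓ ≃+* ℂ) (π : CuspidalAutomorphicRepData n K hcpt)
    (ρ : FramedGaloisRep K (PadicAlgCl ℓ) n) (v : HeightOneSpectrum (𝓞 K))
    (hL : LocalGlobalCompatibleAt Rec ι π.1 ρ v) : LocalGlobalCompatibleAt Rec' ι π.1 ρ v := by
  obtain ⟨πv, r, rℂ, hπv, hlad, hpst, htr, hcls⟩ := hL
  refine ⟨πv, r, rℂ, hπv, hlad, hpst, htr, ?_⟩
  rw [← recGL_eq_of_hasLocalComponentAt hU Rec Rec' hn π v πv hπv]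
  exact hcls

/-- Transport of `Corresponds` along rigid data. [cite: Henniarts1993, Thm 1.1] -/
theorem corresponds_transport
    (hU : ∀ (K : Type) [Field K] [NumberField K] (Rec Rec' : Summit.Langlands.ReciprocityData K) (v : IsDedekindDomain.HeightOneSpectrum (NumberField.RingOfIntegers K)) (n : ℕ) (πv : Literature.NumberTheory.Automorphic.SmoothIrrep (GL (Fin n) (v.adicCompletion K))) (ψ : AddChar (v.adicCompletion K) Circle), ψ.IsContinuousNontrivial → Literature.NumberTheory.Automorphic.IsGeneric πv.ρ ψ → (Rec.llc v).recGL n (Literature.NumberTheory.Automorphic.IrrClass.mk πv) = (Rec'.llc v).recGL n (Literature.NumberTheory.Automorphic.IrrClass.mk πv))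
    (Rec Rec' : ReciprocityData K) (hn : 0 < n) (ι : PadicAlgCl ℓ ≃+* ℂ) (π : CuspidalAutomorphicRepData n K hcpt)
    (ρ : FramedGaloisRep K (PadicAlgCl ℓ) n) (hc : Corresponds Rec ι π.1 ρ) : Corresponds Rec' ι π.1 ρ :=
  ⟨hc.1, fun v ↦ localGlobalCompatibleAt_transport hU Rec Rec' hn ι π ρ v (hc.2 v)⟩

/-- Transport of direction (A) in rank `n ≥ 1` along rigid data. [cite: BuzzardGeeLMS2014, Conj. 3.2.2] -/
theorem automorphicToGalois_transport
    (hU : ∀ (K : Type) [Field K] [NumberField K] (Rec Rec' : Summit.Langlands.ReciprocityData K) (v : IsDedekindDomain.HeightOneSpectrum (NumberField.RingOfIntegers K)) (n : ℕ) (πv : Literature.NumberTheory.Automorphic.SmoothIrrep (GL (Fin n) (v.adicCompletion K))) (ψ : AddChar (v.adicCompletion K) Circle), ψ.IsContinuousNontrivial → Literature.NumberTheory.Automorphic.IsGeneric πv.ρ ψ → (Rec.llc v).recGL n (Literature.NumberTheory.Automorphic.IrrClass.mk πv) = (Rec'.llc v).recGL n (Literature.NumberTheory.Automorphic.IrrClass.mk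 πv))
    (Rec Rec' : ReciprocityData K) (hn : 0 < n) (hA : AutomorphicToGalois n Rec hcpt) :
    AutomorphicToGalois n Rec' hcpt := by
  intro π hLalg ℓ _ ι
  obtain ⟨ρ, hirr, hgeo, hcorr, huniq⟩ := hA π hLalg ℓ ι
  exact ⟨ρ, hirr, hgeo, corresponds_transport hU Rec Rec' hn ι π ρ hcorr,
    fun ρ' hcorr' ↦ huniq ρ' (corresponds_transport hU Rec' Rec hn ι π ρ' hcorr')⟩

/-- Transport of direction (B) in rank `n ≥ 1` along rigid data. [cite: FontaineMazurGeometric1995, Conj. 1] -/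
theorem galoisToAutomorphic_transport
    (hU : ∀ (K : Type) [Field K] [NumberField K] (Rec Rec' : Summit.Langlands.ReciprocityData K) (v : IsDedekindDomain.HeightOneSpectrum (NumberField.RingOfIntegers K)) (n : ℕ) (πv : Literature.NumberTheory.Automorphic.SmoothIrrep (GL (Fin n) (v.adicCompletion K))) (ψ : AddChar (v.adicCompletion K) Circle), ψ.IsContinuousNontrivial → Literature.NumberTheory.Automorphic.IsGeneric πv.ρ ψ → (Rec.llc v).recGL n (Literature.NumberTheory.Automorphic.IrrClass.mk πv) = (Rec'.llc v).recGL n (Literature.NumberTheory.Automorphic.IrrClass.mk πv))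
    (Rec Rec' : ReciprocityData K) (hn : 0 < n) (hB : GaloisToAutomorphic n Rec hcpt) :
    GaloisToAutomorphic n Rec' hcpt := by
  intro ℓ _ ι ρ hirr hgeo
  obtain ⟨π, hLalg, hcorr⟩ := hB ℓ ι ρ hirr hgeo
  exact ⟨π, hLalg, corresponds_transport hU Rec Rec' hn ι π ρ hcorr⟩

end Transport

/-- **The revised summit from the four pieces N, U, A′, B′** (texts). [cite: BuzzardGeeLMS2014, Conj. 3.2.1 and
Conj. 3.2.2] [cite: FontaineMazurGeometric1995, Conj. 1] [cite: Henniarts1993, Thm 1.1]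
[cite: HarrisTaylorAMS2001, Thm. A] -/
theorem langlands_of_pieces
    (hN : ∀ (F : Type) [Field F] [NumberField F], Nonempty (Summit.Langlands.ReciprocityData F))
    (hU : ∀ (K : Type) [Field K] [NumberField K] (Rec Rec' : Summit.Langlands.ReciprocityData K) (v : IsDedekindDomain.HeightOneSpectrum (NumberField.RingOfIntegers K)) (n : ℕ) (πv : Literature.NumberTheory.Automorphic.SmoothIrrep (GL (Fin n) (v.adicCompletion K))) (ψ : AddChar (v.adicCompletion K) Circle), ψ.IsContinuousNontrivial → Literature.NumberTheory.Automorphic.IsGeneric πv.ρ ψ → (Rec.llc v).recGL n (Literature.NumberTheory.Automorphic.IrrClass.mk πv) = (Rec'.llc v).recGL n (Literature.NumberTheory.Automorphic.IrrClass.mk πv))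
    (hA : ∀ (F : Type) [Field F] [NumberField F], Nonempty (Summit.Langlands.ReciprocityData F) → ∃ Rec : Summit.Langlands.ReciprocityData F, ∀ n : ℕ, 0 < n → ∀ hcpt : Literature.NumberTheory.Automorphic.isCompact_glFiniteIntegralLevel n F, Summit.Langlands.AutomorphicToGalois n Rec hcpt)
    (hB : ∀ (F : Type) [Field F] [NumberField F], Nonempty (Summit.Langlands.ReciprocityData F) → ∃ Rec : Summit.Langlands.ReciprocityData F, ∀ n : ℕ, 0 < n → ∀ hcpt : Literature.NumberTheory.Automorphic.isCompact_glFiniteIntegralLevel n F, Summit.Langlands.GaloisToAutomorphic n Rec hcpt) :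
    _root_.Langlands := by
  intro F _ _
  refine ⟨hN F, fun Rec n hn hcpt ↦ ⟨?_, ?_⟩⟩
  · obtain ⟨Rec₀, h₀⟩ := hA F (hN F)
    exact automorphicToGalois_transport hU Rec₀ Rec hn (h₀ n hn hcpt)
  · obtain ⟨Rec₁, h₁⟩ := hB F (hN F)
    exact galoisToAutomorphic_transport hU Rec₁ Rec hn (h₁ n hn hcpt)

/-- **`PhantomRMYoshida.PhantomRMJunction` from its four typed pieces** (BC2 REDIRECT assembly, structural form:
`CanonicalReciprocityData → PinnedRecRigidity → AutomorphicToGaloisOfDatum → GaloisToAutomorphicOfDatum →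
PhantomRMJunction`, every decl unfolded to its text; the sector hypothesis is bound and unused — module
docstring). [cite: BuzzardGeeLMS2014, Conj. 3.2.1 and Conj. 3.2.2] [cite: FontaineMazurGeometric1995, Conj. 1]
[cite: Henniarts1993, Thm 1.1] [cite: HarrisTaylorAMS2001, Thm. A] -/
theorem phantomRMJunction_of_pieces
    (hN : ∀ (F : Type) [Field F] [NumberField F], Nonempty (Summit.Langlands.ReciprocityData F))
    (hU : ∀ (K : Type) [Field K] [NumberField K] (Rec Rec' : Summit.Langlands.ReciprocityData K) (v : IsDedekindDomain.HeightOneSpectrum (NumberField.RingOfIntegers K)) (n : ℕ) (πv : Literature.NumberTheory.Automorphic.SmoothIrrep (GL (Fin n) (v.adicCompletion K))) (ψ : AddChar (v.adicCompletion K) Circle), ψ.IsContinuousNontrivial → Literature.NumberTheory.Automorphic.IsGeneric πv.ρ ψ → (Rec.llc v).recGL n (Literature.NumberTheory.Automorphic.IrrClass.mk πv) = (Rec'.llc v).recGL n (Literature.NumberTheory.Automorphic.IrrClass.mk πv))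
    (hA : ∀ (F : Type) [Field F] [NumberField F], Nonempty (Summit.Langlands.ReciprocityData F) → ∃ Rec : Summit.Langlands.ReciprocityData F, ∀ n : ℕ, 0 < n → ∀ hcpt : Literature.NumberTheory.Automorphic.isCompact_glFiniteIntegralLevel n F, Summit.Langlands.AutomorphicToGalois n Rec hcpt)
    (hB : ∀ (F : Type) [Field F] [NumberField F], Nonempty (Summit.Langlands.ReciprocityData F) → ∃ Rec : Summit.Langlands.ReciprocityData F, ∀ n : ℕ, 0 < n → ∀ hcpt : Literature.NumberTheory.Automorphic.isCompact_glFiniteIntegralLevel n F, Summit.Langlands.GaloisToAutomorphic n Rec hcpt) :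
    ∀ _ : ∀ (p : ℕ) [Fact p.Prime], p ≠ 2 → ∀ (k : Type) [Field k] [CharP k p] [IsAlgClosed k] [TopologicalSpace k] [DiscreteTopology k] (red : Valued.integer (PadicAlgCl p) →+* k) (σ σ' : Literature.NumberTheory.GaloisRepresentations.FramedGaloisRep ℚ k 2) (hcpt : Literature.NumberTheory.Automorphic.isCompact_glFiniteIntegralLevel 4 ℚ) (ι : PadicAlgCl p ≃+* ℂ) (ρ : Literature.NumberTheory.GaloisRepresentations.FramedGaloisRep ℚ (PadicAlgCl p) 4), let εb : Field.absoluteGaloisGroup ℚ →* (ZMod p)ˣ := (modularCyclotomicCharacter (AlgebraicClosure ℚ) (HasEnoughRootsOfUnity.natCard_rootsOfUnity (AlgebraicClosure ℚ) p)).comp (MulSemiringAction.toRingAut (Field.absoluteGaloisGroup ℚ) (AlgebraicClosure ℚ)); σ.IsOdd → σ'.IsOdd → σ.toGaloisRep.IsIrreducible → σ'.toGaloisRep.IsIrreducible → (∀ g, Literature.NumberTheory.GaloisRepresentations.FramedRep.det σ g = (Units.map (ZMod.castHom (dvd_refl p) k).toMonoidHom (εb g))⁻¹ ∧ Literature.NumberTheory.GaloisRepresentations.FramedRep.det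 σ' g = Literature.NumberTheory.GaloisRepresentations.FramedRep.det σ g) → (¬ ∃ g : GL (Fin 2) k, ∀ x, g * σ x * g⁻¹ = σ' x) → ρ.toGaloisRep.IsIrreducible → (ρ.IsSymplecticWithMultiplierFun (fun g => algebraMap ℚ_[p] (PadicAlgCl p) ((((Literature.NumberTheory.GaloisRepresentations.GaloisRep.cyclotomicCharacter ℚ p g)⁻¹ : ℤ_[p]ˣ) : ℤ_[p]) : ℚ_[p])) ∧ (∀ v : IsDedekindDomain.HeightOneSpectrum (NumberField.RingOfIntegers ℚ), ((p : ℕ) : NumberField.RingOfIntegers ℚ) ∈ v.asIdeal → ρ.IsGreenbergOrdinaryOfShapeAt v ![0, 0, 1, 1] ∧ ρ.IsResiduallyDistinguishedAt v ![0, 0, 1, 1]) ∧ (∀ᶠ v : IsDedekindDomain.HeightOneSpectrum (NumberField.RingOfIntegers ℚ) in Filter.cofinite, ρ.IsUnramifiedAt v ∧ σ.IsUnramifiedAt v ∧ σ'.IsUnramifiedAt v ∧ ∃ (P : Polynomial (Valued.integer (PadicAlgCl p))) (P₁ P₂ : Polynomial k), ρ.HasFrobCharpolyAt v (P.map (Valued.integer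 (PadicAlgCl p)).subtype) ∧ σ.HasFrobCharpolyAt v P₁ ∧ σ'.HasFrobCharpolyAt v P₂ ∧ P.map red = P₁ * P₂)) → ∃ π : Literature.NumberTheory.Automorphic.CuspidalAutomorphicRepData 4 ℚ hcpt, π.1.IsLAlgebraic ∧ ∀ᶠ v : IsDedekindDomain.HeightOneSpectrum (NumberField.RingOfIntegers ℚ) in Filter.cofinite, ∃ a : Multiset ℂ, π.1.HasSatakeParamAt v a ∧ ρ.IsUnramifiedAt v ∧ ρ.HasFrobCharpolyAt v (Literature.NumberTheory.Automorphic.arithFrobPolyOfSatake ι v.residueCard 1 a), _root_.Langlands :=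
  fun _ ↦ langlands_of_pieces hN hU hA hB

end Summit.Langlands.Langlands.Theorems.PhantomRMYoshidaJunctionSplit

end
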